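import Summits.Ventures.CertifiedManyBodySolver.Rows.HomTorusTTPrimeModel
import Summits.Ventures.CertifiedManyBodySolver.Rows.HomTorusEnergyDensity
import HarnessLib

/-!
# `t–t'` Hubbard tori generated by an additive lattice map (Part II: the energy density)

HONEST FRAMING: first certified bounds; not a superconductivity verdict; every number certified or
labelled float. INFRASTRUCTURE (continues `HomTorusTTPrimeModel`): the objective of a `t–t'` window
certificate, pulled back into the torus generated by `φ : ℤ² →+ (ℤ/Nℤ)^{d'}` through
`[-1,1]² ↪ (ℤ/Nℤ)^{d'}`, `x ↦ φ x`, has translates summing to the `t–t'` torus Hamiltonian: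
* `fermionEmbed_homEmb_diag_meanEnergyObs` — `Γ(ι) E^{t'}_Φ` expanded on the torus sites `0`, `±φ j_s`;
* `sum_relabel_translate_homEmb_diag_meanEnergyObs` — `Σ_v T_v (Γ(ι) E^{t'}_Φ) T_v⁻¹ =
  homHubbard (φ ∘ D) t' 0` (the diagonal hopping Hamiltonian), for NON-DEGENERATE DIAGONAL HOPS
  `Function.Injective (signedHop (φ.comp diagMap))` (the four signed hops `±φ j₀, ±φ j₁` pairwise
  distinct; for `crtHom34`: `{±1, ∓5}` mod `12`, for `crtHom35`: `{±1, ±4}` mod `15`);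
* `sum_relabel_translate_homEmb_TTPrime_meanEnergyObs` — with Part III of `HomTorusEnergyDensity`:
  `Σ_v T_v (Γ(ι) E^{tt'}_Φ) T_v⁻¹ = homHubbardTT' φ t t' U`.
Patterned on the tree's `HubbardNNNHoppingInteractionTorus` (`x ↦ x mod L`) and on
`HomTorusEnergyDensity`. [cite: BratteliRobinsonII1997, §6.2.4] [cite: XuEtAl2024, eq. (1)]
[cite: Han2020Bootstrap, §3]
-/

noncomputable section

open Matrix Finset
open Literature.MathematicalPhysics.QuantumLattice
open Literature.MathematicalPhysics.QuantumFieldTheory hiding Site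
open Literature.MathematicalPhysics.QuantumManyBody.StateRelaxation
open Literature.Probability.LatticeModels
open HubbardWave0
open scoped ComplexOrder ComplexConjugate

namespace Summit.Ventures.CertifiedManyBodySolver.Rows

section EnergyDensity

variable {d' N : ℕ} [NeZero N] (φ : Site 2 →+ TorusSite d' N) (t t' U : ℝ)

/-- **`E^{t'}_Φ` in the torus generated by `φ`**: for `φ` injective on `[-1,1]²`, the second
quantisation `Γ(ι)` maps the mean-energy observable of the diagonal hopping interaction to
`Σ_s ½·(-t') Σ_σ (c†_0 c_{φ j_s} + c†_{φ j_s} c_0 + (c†_{-φ j_s} c_0 + c†_0 c_{-φ j_s}))`.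
[cite: BratteliRobinsonII1997, §6.2.4] -/
theorem fermionEmbed_homEmb_diag_meanEnergyObs (hT : Set.InjOn φ ↑(thicken ({0} : Finset (Site 2)) 1)) :
    fermionEmbed (homEmb φ hT) ((diagHoppingFermionInteraction t').meanEnergyObs 1) =
      ∑ s : Fin 2, ((2 : ℂ)⁻¹ * -(t' : ℂ)) • ∑ σ : Fin 2,
        ((creation (orb (FermionTorus.ofTorusSite (0 : TorusSite d' N)) σ) *
            annihilation (orb (FermionTorus.ofTorusSite (φ (diagVec s))) σ) +
          creation (orb (FermionTorus.ofTorusSite (φ (diagVec s))) σ) *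
            annihilation (orb (FermionTorus.ofTorusSite (0 : TorusSite d' N)) σ)) +
        (creation (orb (FermionTorus.ofTorusSite (-φ (diagVec s))) σ) *
            annihilation (orb (FermionTorus.ofTorusSite (0 : TorusSite d' N)) σ) +
          creation (orb (FermionTorus.ofTorusSite (0 : TorusSite d' N)) σ) *
            annihilation (orb (FermionTorus.ofTorusSite (-φ (diagVec s))) σ))) := by
  have hc : ∀ {X : Finset (Site 2)} (hX : X ⊆ thicken ({0} : Finset (Site 2)) 1) (x : Site 2) (hx : x ∈ X)
      (σ : Fin 2),
      fermionEmbed ((PolySite.incl hX).trans (homEmb φ hT)) (cAt x hx σ) =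
        annihilation (orb (FermionTorus.ofTorusSite (φ x)) σ) := by
    intro X hX x hx σ
    rw [cAt, fermionEmbed_annihilation]
    rfl
  have hcd : ∀ {X : Finset (Site 2)} (hX : X ⊆ thicken ({0} : Finset (Site 2)) 1) (x : Site 2) (hx : x ∈ X)
      (σ : Fin 2),
      fermionEmbed ((PolySite.incl hX).trans (homEmb φ hT)) ((cAt x hx σ)ᴴ) =
        creation (orb (FermionTorus.ofTorusSite (φ x)) σ) := by
    intro X hX x hx σ
    rw [cAt, annihilation_conjTranspose, fermionEmbed_creation]
    rfl
  rw [diagHoppingFermionInteraction_meanEnergyObs, fermionEmbed_sum]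
  refine Finset.sum_congr rfl fun s _ => ?_
  rw [fermionEmbed_add, fermionEmbed_smul, fermionEmbed_smul, fermionEmbed_fermionEmbed, fermionEmbed_fermionEmbed,
    diagHoppingFermionInteraction_apply_pair, diagHoppingFermionInteraction_apply_pair, fermionEmbed_smul,
    fermionEmbed_smul, fermionEmbed_sum, fermionEmbed_sum, smul_smul, smul_smul, ← smul_add, ← Finset.sum_add_distrib]
  congr 1
  refine Finset.sum_congr rfl fun σ _ => ?_
  rw [fermionEmbed_add, fermionEmbed_add, fermionEmbed_mul, fermionEmbed_mul, fermionEmbed_mul, fermionEmbed_mul,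
    hc, hc, hc, hc, hcd, hcd, hcd, hcd, zero_add, neg_add_cancel, map_zero, map_neg]

/-- **The translates of `Γ(ι) E^{t'}_Φ` sum to the diagonal hopping Hamiltonian of the torus generated
by `φ`**, for non-degenerate diagonal hops (`±φ j₀, ±φ j₁` pairwise distinct):
`Σ_v T_v (Γ(ι) E^{t'}_Φ) T_v⁻¹ = homHubbard (φ ∘ D) t' 0` (every diagonal torus bond `{x, x ± φ j_s}`
is a bond through `v` for exactly its two endpoints, each with weight `½`). Bratteli–Robinson II §6.2.4
(periodic boundary conditions). [cite: BratteliRobinsonII1997, §6.2.4] -/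
theorem sum_relabel_translate_homEmb_diag_meanEnergyObs
    (hT : Set.InjOn φ ↑(thicken ({0} : Finset (Site 2)) 1)) (hdist : Function.Injective (signedHop (φ.comp diagMap))) :
    ∑ v : TorusSite d' N, relabel (Orb.translate v)
        (fermionEmbed (homEmb φ hT) ((diagHoppingFermionInteraction t').meanEnergyObs 1)) =
      homHubbard (φ.comp diagMap) t' 0 := by
  -- abbreviations for the torus operators
  set o : TorusSite d' N → FermionTorus d' N := FermionTorus.ofTorusSite with ho
  set cd : TorusSite d' N → Fin 2 → Matrix (Finset (Orb (FermionTorus d' N))) (Finset (Orb (FermionTorus d' N))) ℂ :=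
    fun x σ => creation (orb (o x) σ) with hcd
  set c : TorusSite d' N → Fin 2 → Matrix (Finset (Orb (FermionTorus d' N))) (Finset (Orb (FermionTorus d' N))) ℂ :=
    fun x σ => annihilation (orb (o x) σ) with hc
  -- the translate by `v` of `Γ(ι) E^{t'}_Φ`
  have hcomm : ∀ (w : TorusSite d' N) (s : Fin 2), φ (diagVec s) + w = w + φ (diagVec s) :=
    fun w s => add_comm _ _
  have htrans : ∀ v : TorusSite d' N, relabel (Orb.translate v)
      (fermionEmbed (homEmb φ hT) ((diagHoppingFermionInteraction t').meanEnergyObs 1)) =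
      ∑ s : Fin 2, ((2 : ℂ)⁻¹ * -(t' : ℂ)) • ∑ σ : Fin 2,
        ((cd v σ * c (v + φ (diagVec s)) σ + cd (v + φ (diagVec s)) σ * c v σ) +
          (cd (v - φ (diagVec s)) σ * c v σ + cd v σ * c (v - φ (diagVec s)) σ)) := by
    intro v
    rw [fermionEmbed_homEmb_diag_meanEnergyObs φ t' hT, relabel_sum]
    simp only [relabel_smul, relabel_sum, relabel_add, relabel_mul, relabel_creation, relabel_annihilation,
      Orb.translate_orb, zero_add, neg_add_eq_sub, hcomm]
    rfl
  simp_rw [htrans]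
  rw [Finset.sum_comm]
  -- the Hamiltonian, with all sums over `TorusSite`
  have hH : homHubbard (φ.comp diagMap) t' 0 =
      -(t' : ℂ) • (∑ v : TorusSite d' N, ∑ s : Fin 2, ∑ σ : Fin 2,
          (cd v σ * c (v + φ (diagVec s)) σ + cd v σ * c (v - φ (diagVec s)) σ)) := by
    rw [homHubbard, hamiltonian, Complex.ofReal_zero, zero_smul, add_zero]
    congr 1
    rw [← Fintype.sum_equiv FermionTorus.equivTorusSite.symm
      (fun v : TorusSite d' N => ∑ s : Fin 2, ∑ σ : Fin 2,
        (cd v σ * c (v + φ (diagVec s)) σ + cd v σ * c (v - φ (diagVec s)) σ)) _ (fun v => ?_)]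
    rw [← Fintype.sum_equiv FermionTorus.equivTorusSite.symm
      (fun w : TorusSite d' N => ∑ σ : Fin 2,
        if (homTorusGraph (φ.comp diagMap)).Adj (FermionTorus.equivTorusSite.symm v) (o w) then
          creation (orb (FermionTorus.equivTorusSite.symm v) σ) * annihilation (orb (o w) σ) else 0)
      _ (fun w => rfl)]
    have hv : (FermionTorus.equivTorusSite.symm v : FermionTorus d' N) = o v := rfl
    simp_rw [hv]
    have hadj : ∀ w : TorusSite d' N, (homTorusGraph (φ.comp diagMap)).Adj (o v) (o w) ↔
        (homSiteGraph (φ.comp diagMap)).Adj v w := by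
      intro w; rw [ho]; exact homTorusGraph_adj_ofTorusSite (φ.comp diagMap) v w
    have hite : ∀ w : TorusSite d' N, (∑ σ : Fin 2,
        if (homTorusGraph (φ.comp diagMap)).Adj (o v) (o w) then creation (orb (o v) σ) * annihilation (orb (o w) σ)
          else 0) =
        if (homSiteGraph (φ.comp diagMap)).Adj v w then ∑ σ : Fin 2, cd v σ * c w σ else 0 := by
      intro w
      by_cases h : (homSiteGraph (φ.comp diagMap)).Adj v w
      · rw [if_pos h]
        exact Finset.sum_congr rfl fun σ _ => by rw [if_pos ((hadj _).2 h)]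
      · rw [if_neg h]
        exact Finset.sum_eq_zero fun σ _ => by rw [if_neg (fun h' => h ((hadj _).1 h'))]
    simp_rw [hite]
    rw [sum_ite_homSiteGraph_adj (φ.comp diagMap) hdist v]
    simp only [comp_diagMap_unitVec, Finset.sum_add_distrib]
  rw [hH]
  -- the hopping part: each bond is counted twice with weight ½
  simp only [Finset.smul_sum]
  conv_rhs => rw [Finset.sum_comm]
  refine Finset.sum_congr rfl fun s _ => ?_
  have hshift1 : ∑ v : TorusSite d' N, ∑ σ : Fin 2, ((2 : ℂ)⁻¹ * -(t' : ℂ)) • (cd (v + φ (diagVec s)) σ * c v σ) =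
      ∑ v : TorusSite d' N, ∑ σ : Fin 2, ((2 : ℂ)⁻¹ * -(t' : ℂ)) • (cd v σ * c (v - φ (diagVec s)) σ) :=
    (TorusSite.sum_sub_shift (φ (diagVec s))
      (fun a b => ∑ σ : Fin 2, ((2 : ℂ)⁻¹ * -(t' : ℂ)) • (cd a σ * c b σ))).symm
  have hshift2 : ∑ v : TorusSite d' N, ∑ σ : Fin 2, ((2 : ℂ)⁻¹ * -(t' : ℂ)) • (cd (v - φ (diagVec s)) σ * c v σ) =
      ∑ v : TorusSite d' N, ∑ σ : Fin 2, ((2 : ℂ)⁻¹ * -(t' : ℂ)) • (cd v σ * c (v + φ (diagVec s)) σ) :=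
    TorusSite.sum_sub_shift (φ (diagVec s))
      (fun a b => ∑ σ : Fin 2, ((2 : ℂ)⁻¹ * -(t' : ℂ)) • (cd b σ * c a σ))
  simp only [smul_add, Finset.sum_add_distrib]
  rw [hshift1, hshift2]
  have ha : ((2 : ℂ)⁻¹ * -(t' : ℂ)) + ((2 : ℂ)⁻¹ * -(t' : ℂ)) = -(t' : ℂ) := by ring
  simp only [← Finset.smul_sum]
  conv_rhs => rw [← ha, add_smul, add_smul]
  abel

/-- **The translates of the mean-energy observable of the `t–t'` interaction sum to the `t–t'`
Hamiltonian of the torus generated by `φ`**: for `φ` injective on `[-1,1]²` with non-degenerate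
nearest-neighbour hops (`±φ e₀, ±φ e₁` pairwise distinct) and non-degenerate diagonal hops
(`±φ j₀, ±φ j₁` pairwise distinct),
`Σ_v T_v (Γ(ι) E^{tt'}_Φ) T_v⁻¹ = homHubbardTT' φ t t' U` — the objective of a reduce-mode
(window) certificate for the `t–t'` Hubbard model (Han 2020 §3) is the energy per site of
`homHubbardTT' φ`. [cite: BratteliRobinsonII1997, §6.2.4] [cite: Han2020Bootstrap, §3] -/
theorem sum_relabel_translate_homEmb_TTPrime_meanEnergyObs
    (hT : Set.InjOn φ ↑(thicken ({0} : Finset (Site 2)) 1)) (hdist : Function.Injective (signedHop φ))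
    (hdist' : Function.Injective (signedHop (φ.comp diagMap))) :
    ∑ v : TorusSite d' N, relabel (Orb.translate v)
        (fermionEmbed (homEmb φ hT) ((hubbardTTPrimeFermionInteraction t t' U).meanEnergyObs 1)) =
      homHubbardTT' φ t t' U := by
  simp_rw [hubbardTTPrimeFermionInteraction_meanEnergyObs, fermionEmbed_add, relabel_add, Finset.sum_add_distrib,
    sum_relabel_translate_homEmb_meanEnergyObs φ t U hT hdist, sum_relabel_translate_homEmb_diag_meanEnergyObs φ t' hT hdist']
  rfl

end EnergyDensity

end Summit.Ventures.CertifiedManyBodySolver.Rows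

end
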